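import Literature.NumberTheory.Automorphic.SchwartzPiHomothetyCoinvariants
import Literature.NumberTheory.Automorphic.UnitaryGroupSplitPlace
import Literature.NumberTheory.Automorphic.ParabolicIndGLDetCharIrreducible
import Literature.RepresentationTheory.HeisenbergGroup.SchrodingerPiOperators
import Literature.AlgebraicGeometry.Motives.AbelianVarietyMirabolicGassmannPair
import HarnessLib

/-!
# The line functional `Ψ ↦ ∫_{Fˣ} χ(t)⁻¹ (π(t·1)Ψ)(e_n) d^×t` on `𝒮(Fⁿ)` for the mixed model of `GL_n`

Topic `NumberTheory/Automorphic`; namespace `Literature.NumberTheory.Automorphic.SchwartzPiLine`.  KERNEL ONLY: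
theorems; no definition, no named fact, no `sorry`.  Sequel of `SchwartzPiHomothetyCoinvariants.lean`.

SETTING ([MoeglinVignerasWaldspurger1987, Chap. 3 §III.1, III.7]; the split-place mixed model of
`Liu2021/SplitPlaceMixedModel.lean`): `F` a non-archimedean local field, `N ≥ 1`, a representation `π` of `GL_N(F)` on
`𝒮(Fᴺ)` of the MIXED-MODEL SHAPE `π(a) = ν(det a) · r(m(a⁻ᵀ))`, i.e. `(π(a)Ψ)(x) = ν(det a) |det a|^{1/2} Ψ(ᵗa x)`
(`leviOpPi`, `ν : Fˣ →* ℂˣ`), a character `χ : Fˣ →* ℂˣ` of the centre `t ↦ t · 1_N`, both UNITARY with OPEN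
KERNEL, a Haar measure `μ'` on `Fˣ`, and the last basis vector `e = e_{N-1}`.

* §1 `GL_N` on the last basis covector: `ᵗq e = q_{N-1,N-1} e` for `q` in the maximal parabolic `Q = Q_{N-1,1}`
  (`standardParabolicGL F (lastBlockLabel N)`, block UPPER triangular, `GL_{N-1}` block first), and `ᵗg e` runs through
  all non-zero vectors (`exists_transpose_mulVec_single_eq`, from the tree's `MirabolicGassmann.exists_GL_mulVec_single_eq`).
* §2 the mixed-model formulas: `(π(a)Ψ)(x) = ν(det a) (modSqrt a⁻ᵀ)⁻¹ Ψ(ᵗa x)`, `modSqrt(a⁻ᵀ)⁻¹ = |det a|^{1/2}`, the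
  centre acts by the twisted homotheties `(π(t·1)Ψ)(x) = ν(t)ᴺ √(|t|ᴺ) Ψ(t x)`.
* §3 **absolute convergence**: for `x ≠ 0` the orbital integrand `t ↦ χ(t)⁻¹ (π(t·1)Ψ)(x)` is integrable on `Fˣ` for
  EVERY `Ψ ∈ 𝒮(Fᴺ)` — `|·| = |t|^{N/2} |Ψ(t x)| ≤ C 1_{𝔭^n}(t) |t|^{N/2}` (Tate's convergence for exponent `> 0`,
  tree `integrable_units_of_norm_le`); [MoeglinVignerasWaldspurger1987, III.7 a)]: for unitary `χ` the `χ`-quotient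
  ignores the origin.

## References
* [MoeglinVignerasWaldspurger1987] C. Mœglin, M.-F. Vignéras, J.-L. Waldspurger, LNM 1291 (1987), Chap. 3 §III.1, III.7 a).
* [Tate1950] J. Tate, §2.4 (convergence of zeta integrals for exponent `> 0`).
* [Zelevinsky1980] A. V. Zelevinsky, Ann. Sci. ÉNS 13 (1980), §1.1 (the standard parabolics of `GL_n`).
-/

set_option autoImplicit false

noncomputable section

open scoped NNReal ENNReal Topology Pointwise MatrixGroups Matrix
open MeasureTheory ValuativeRel Filter Set Function
  Literature.NumberTheory.GaloisRepresentations.IsNonarchimedeanLocalField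
open Literature.RepresentationTheory (TwistedCoinv.ker TwistedCoinv.sub_mem_ker)
open Literature.RepresentationTheory.HeisenbergGroup Literature.RepresentationTheory.HeisenbergGroup.SymplecticMatrix
open Literature.NumberTheory.Automorphic.Zelevinsky1980 (lastBlockLabel)

namespace Literature.NumberTheory.Automorphic.SchwartzPiLine

/-! ## §1 The last basis covector under `Q_{N-1,1}` and under `GL_N` -/

section Vector

variable {F : Type} [Field F] {N : ℕ}

/-- the last index `N - 1` of `Fin N` is labelled `true`. [folklore] -/
private theorem lastBlockLabel_last (hN : 1 ≤ N) : lastBlockLabel N ⟨N - 1, by omega⟩ = true := by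
  rw [Zelevinsky1980.lastBlockLabel_apply, decide_eq_true_eq]; simp only; omega

/-- an index labelled `false` is not the last one. [folklore] -/
private theorem lastBlockLabel_eq_false_iff (hN : 1 ≤ N) (j : Fin N) :
    lastBlockLabel N j = false ↔ j ≠ ⟨N - 1, by omega⟩ := by
  rw [Zelevinsky1980.lastBlockLabel_apply, decide_eq_false_iff_not, not_le, Ne, Fin.ext_iff]
  simp only
  omega

/-- **`ᵗq e_{N-1} = q_{N-1,N-1} · e_{N-1}` for `q ∈ Q_{N-1,1}`**: the last row of a block upper triangular matrix with
the `GL_1` block last is `(0, …, 0, q_{N-1,N-1})`. [cite: Zelevinsky1980, §1.1, p. 170] -/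
theorem transpose_mulVec_single_last (hN : 1 ≤ N) (q : standardParabolicGL F (lastBlockLabel N)) :
    (((q : GL (Fin N) F) : Matrix (Fin N) (Fin N) F))ᵀ *ᵥ Pi.single (⟨N - 1, by omega⟩ : Fin N) (1 : F) =
      ((q : GL (Fin N) F) : Matrix (Fin N) (Fin N) F) ⟨N - 1, by omega⟩ ⟨N - 1, by omega⟩ •
        Pi.single (⟨N - 1, by omega⟩ : Fin N) (1 : F) := by
  funext j
  rw [Matrix.mulVec_single_one, Matrix.col_apply, Matrix.transpose_apply, Pi.smul_apply, smul_eq_mul]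
  by_cases hj : j = ⟨N - 1, by omega⟩
  · subst hj; rw [Pi.single_eq_same, mul_one]
  · rw [Pi.single_eq_of_ne hj, mul_zero]
    have hq := blockTriangular_of_mem q
    apply hq
    rw [(lastBlockLabel_eq_false_iff hN j).2 hj, lastBlockLabel_last hN]
    exact Bool.false_lt_true

/-- **`GL_N(F)` moves `e_{i₀}` to every non-zero covector**: `∃ g, ᵗg e_{i₀} = x` (transpose of the tree's transitivity on
non-zero vectors). [cite: Zelevinsky1980, §1.1, p. 170] -/
theorem exists_transpose_mulVec_single_eq [DecidableEq (Fin N)] (i₀ : Fin N) {x : Fin N → F} (hx : x ≠ 0) :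
    ∃ g : GL (Fin N) F, ((g : GL (Fin N) F) : Matrix (Fin N) (Fin N) F)ᵀ *ᵥ Pi.single i₀ (1 : F) = x := by
  obtain ⟨g, hg⟩ := AlgebraicGeometry.Motives.MirabolicGassmann.exists_GL_mulVec_single_eq i₀ hx
  refine ⟨(GLn.contragredient g)⁻¹, ?_⟩
  rw [GLn.coe_contragredient_inv, Matrix.transpose_transpose]
  convert hg

/-- the scalar matrix `t · 1_N ∈ GL_N(F)` has matrix `t • 1`. [cite: Zelevinsky1980, §1.1, p. 170] -/
theorem coe_scalar (t : Fˣ) :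
    ((Units.map (Matrix.scalar (Fin N)).toMonoidHom t : GL (Fin N) F) : Matrix (Fin N) (Fin N) F) =
      (t : F) • (1 : Matrix (Fin N) (Fin N) F) := by
  rw [Units.coe_map, RingHom.toMonoidHom_eq_coe, MonoidHom.coe_coe, Matrix.scalar_apply, Matrix.smul_one_eq_diagonal]

/-- `det (t · 1_N) = tᴺ` in `Fˣ`. [cite: Zelevinsky1980, §1.1, p. 170] -/
theorem det_scalar (t : Fˣ) :
    Matrix.GeneralLinearGroup.det (Units.map (Matrix.scalar (Fin N)).toMonoidHom t) = t ^ N := by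
  ext
  rw [Matrix.GeneralLinearGroup.val_det_apply, coe_scalar, Matrix.det_smul, Matrix.det_one, mul_one, Fintype.card_fin,
    Units.val_pow_eq_pow_val]

/-- the scalar matrices `t · 1_N` are central in `GL_N(F)`. [cite: Zelevinsky1980, §1.1, p. 170] -/
theorem scalar_mul_comm (t : Fˣ) (g : GL (Fin N) F) :
    Units.map (Matrix.scalar (Fin N)).toMonoidHom t * g = g * Units.map (Matrix.scalar (Fin N)).toMonoidHom t := by
  apply Units.ext
  rw [Units.val_mul, Units.val_mul, coe_scalar, Matrix.smul_mul, Matrix.mul_smul, Matrix.one_mul, Matrix.mul_one]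

end Vector

/-! ## §2 The mixed-model formulas -/

section Model

variable {F : Type} [Field F] [ValuativeRel F] [TopologicalSpace F] [IsNonarchimedeanLocalField F] {N : ℕ}
  (π : Representation ℂ (GL (Fin N) F) (SchwartzBruhat (Fin N → F))) (ν : Fˣ →* ℂˣ)
  (hπ : ∀ (a : GL (Fin N) F) (Ψ : SchwartzBruhat (Fin N → F)),
    π a Ψ = ((ν (Matrix.GeneralLinearGroup.det a) : ℂˣ) : ℂ) • leviOpPi (glEquiv (GLn.contragredient a)) Ψ)

/-- `(r(m(a⁻ᵀ)) Φ)(x) = (modSqrt a⁻ᵀ)⁻¹ · Φ(ᵗa x)`. [cite: MoeglinVignerasWaldspurger1987, Chap. 3 §III.1] -/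
theorem coe_leviOpPi_contragredient_apply (a : GL (Fin N) F) (Φ : SchwartzBruhat (Fin N → F)) (x : Fin N → F) :
    ((leviOpPi (glEquiv (GLn.contragredient a)) Φ : SchwartzBruhat (Fin N → F)) : (Fin N → F) → ℂ) x =
      ((modSqrt (glEquiv (GLn.contragredient a)) : ℂ))⁻¹ *
        (Φ : (Fin N → F) → ℂ) ((((a : GL (Fin N) F) : Matrix (Fin N) (Fin N) F))ᵀ *ᵥ x) := by
  rw [coe_leviOpPi_apply, glEquiv_symm_apply, GLn.coe_contragredient_inv]

omit [ValuativeRel F] [TopologicalSpace F] [IsNonarchimedeanLocalField F] in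
/-- `a ↦ glEquiv a` is multiplicative. [folklore] -/
private theorem glEquiv_mul (a b : GL (Fin N) F) : glEquiv (a * b) = glEquiv a * glEquiv b := by
  apply LinearEquiv.ext; intro x
  rw [LinearEquiv.mul_apply, glEquiv_apply, glEquiv_apply, glEquiv_apply, Units.val_mul, Matrix.mulVec_mulVec]

/-- `a ↦ modSqrt(glEquiv a⁻ᵀ)` is multiplicative. [cite: Rangarao1993, Thm 3.5 (3)] -/
theorem modSqrt_contragredient_mul (a b : GL (Fin N) F) :
    modSqrt (glEquiv (GLn.contragredient (a * b))) =
      modSqrt (glEquiv (GLn.contragredient a)) * modSqrt (glEquiv (GLn.contragredient b)) := by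
  rw [map_mul, glEquiv_mul, modSqrt_mul]

/-- `|det a⁻ᵀ|^{1/2} = |det a|^{-1/2}`: `modSqrt (glEquiv a⁻ᵀ) = (√|det a|)⁻¹`. [cite: WeilBNT1967, Chap. I §2 Th. 3 Cor. 3] -/
theorem modSqrt_glEquiv_contragredient (a : GL (Fin N) F) :
    modSqrt (glEquiv (GLn.contragredient a)) =
      (Real.sqrt (normAbs F ((Matrix.GeneralLinearGroup.det a : Fˣ) : F)))⁻¹ := by
  have hlin : ∀ b : GL (Fin N) F, ((glEquiv b : (Fin N → F) ≃ₗ[F] (Fin N → F)) : (Fin N → F) →ₗ[F] (Fin N → F)) =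
      Matrix.toLin' ((b : GL (Fin N) F) : Matrix (Fin N) (Fin N) F) := fun b => by
    apply LinearMap.ext; intro x; simp [Matrix.toLin'_apply]
  rw [modSqrt, hlin, LinearMap.det_toLin', GLn.coe_contragredient, Matrix.det_transpose,
    show (((a⁻¹ : GL (Fin N) F) : Matrix (Fin N) (Fin N) F)).det = ((Matrix.GeneralLinearGroup.det a⁻¹ : Fˣ) : F) from
      (Matrix.GeneralLinearGroup.val_det_apply _).symm, map_inv, Units.val_inv_eq_inv_val, map_inv₀, NNReal.coe_inv,
    Real.sqrt_inv]

include hπ in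
/-- **the mixed-model formula**: `(π(a)Ψ)(x) = ν(det a) · (modSqrt a⁻ᵀ)⁻¹ · Ψ(ᵗa x)`. [cite: MoeglinVignerasWaldspurger1987, Chap. 3 §III.1] -/
theorem apply_apply (a : GL (Fin N) F) (Ψ : SchwartzBruhat (Fin N → F)) (x : Fin N → F) :
    (π a Ψ : (Fin N → F) → ℂ) x = ((ν (Matrix.GeneralLinearGroup.det a) : ℂˣ) : ℂ) *
      (((modSqrt (glEquiv (GLn.contragredient a)) : ℂ))⁻¹ *
        (Ψ : (Fin N → F) → ℂ) ((((a : GL (Fin N) F) : Matrix (Fin N) (Fin N) F))ᵀ *ᵥ x)) := by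
  rw [hπ, Submodule.coe_smul, Pi.smul_apply, smul_eq_mul, coe_leviOpPi_contragredient_apply]

include hπ in
/-- **the centre acts by twisted homotheties**: `(π(t·1)Ψ)(x) = ν(t)ᴺ √(|t|ᴺ) Ψ(t x)` — the shape
`(π t Ψ)(x) = c(t) Ψ(t x)` of `SchwartzPiHomothetyCoinvariants.lean`. [cite: MoeglinVignerasWaldspurger1987, Chap. 3 §III.1] -/
theorem apply_scalar_apply (t : Fˣ) (Ψ : SchwartzBruhat (Fin N → F)) (x : Fin N → F) :
    (π (Units.map (Matrix.scalar (Fin N)).toMonoidHom t) Ψ : (Fin N → F) → ℂ) x =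
      ((ν t : ℂˣ) : ℂ) ^ N * ((Real.sqrt ((normAbs F (t : F) : ℝ) ^ N) : ℂ) * (Ψ : (Fin N → F) → ℂ) ((t : F) • x)) := by
  rw [apply_apply π ν hπ, modSqrt_glEquiv_contragredient, det_scalar, map_pow, Units.val_pow_eq_pow_val, coe_scalar,
    Matrix.transpose_smul, Matrix.transpose_one, Matrix.smul_mulVec, Matrix.one_mulVec, Units.val_pow_eq_pow_val,
    map_pow, ← Complex.ofReal_inv, inv_inv, NNReal.coe_pow]

end Model

/-! ## §3 Absolute convergence of the orbital integrals on all of `𝒮(Fᴺ)` -/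

section Convergence

variable {F : Type} [Field F] [ValuativeRel F] [TopologicalSpace F] [IsNonarchimedeanLocalField F]
  [MeasurableSpace F] [BorelSpace F] {N : ℕ}
  (π : Representation ℂ (GL (Fin N) F) (SchwartzBruhat (Fin N → F))) (ν χ : Fˣ →* ℂˣ)
  (hπ : ∀ (a : GL (Fin N) F) (Ψ : SchwartzBruhat (Fin N → F)),
    π a Ψ = ((ν (Matrix.GeneralLinearGroup.det a) : ℂˣ) : ℂ) • leviOpPi (glEquiv (GLn.contragredient a)) Ψ)
  (μ' : Measure Fˣ)

omit [MeasurableSpace F] [BorelSpace F] in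
/-- a character of `Fˣ` with open kernel is continuous. [folklore] -/
private theorem continuous_coe_of_isOpen_ker (θ : Fˣ →* ℂˣ) (hθ : IsOpen (θ.ker : Set Fˣ)) :
    Continuous fun t : Fˣ => ((θ t : ℂˣ) : ℂ) := by
  refine continuous_iff_continuousAt.2 fun t₀ => ?_
  have hev : ∀ᶠ t in 𝓝 t₀, ((θ t : ℂˣ) : ℂ) = ((θ t₀ : ℂˣ) : ℂ) := by
    have hc : Continuous fun t : Fˣ => t₀⁻¹ * t := continuous_const.mul continuous_id
    have h1 : (fun t => t₀⁻¹ * t) ⁻¹' (θ.ker : Set Fˣ) ∈ 𝓝 t₀ := by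
      refine hc.continuousAt.preimage_mem_nhds ?_
      have : t₀⁻¹ * t₀ = 1 := inv_mul_cancel t₀
      rw [this]; exact hθ.mem_nhds (Subgroup.one_mem _)
    refine Filter.mem_of_superset h1 fun t ht => ?_
    have ht' : θ (t₀⁻¹ * t) = 1 := ht
    rw [map_mul, map_inv, inv_mul_eq_one] at ht'
    change ((θ t : ℂˣ) : ℂ) = ((θ t₀ : ℂˣ) : ℂ)
    rw [ht']
  exact continuousAt_const.congr (hev.mono fun t ht => ht.symm)

omit [MeasurableSpace F] [BorelSpace F] in
include hπ in
/-- the orbital integrand in closed form: `χ(t)⁻¹ (π(t·1)Ψ)(x) = χ(t⁻¹) ν(t)ᴺ √(|t|ᴺ) Ψ(t x)`.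
[cite: MoeglinVignerasWaldspurger1987, Chap. 3 §III.1] -/
theorem orbitalIntegrand_eq (t : Fˣ) (Ψ : SchwartzBruhat (Fin N → F)) (x : Fin N → F) :
    (((χ t)⁻¹ : ℂˣ) : ℂ) * (π (Units.map (Matrix.scalar (Fin N)).toMonoidHom t) Ψ : (Fin N → F) → ℂ) x =
      ((χ t⁻¹ : ℂˣ) : ℂ) * (((ν t : ℂˣ) : ℂ) ^ N *
        ((Real.sqrt ((normAbs F (t : F) : ℝ) ^ N) : ℂ) * (Ψ : (Fin N → F) → ℂ) ((t : F) • x))) := by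
  rw [apply_scalar_apply π ν hπ, map_inv]

include hπ in
/-- **absolute convergence of the orbital integrals for every `Ψ ∈ 𝒮(Fᴺ)`** ([MoeglinVignerasWaldspurger1987, III.7 a)]:
for `x ≠ 0`, unitary `ν, χ` with open kernels and `N ≥ 1`, `t ↦ χ(t)⁻¹ (π(t·1)Ψ)(x)` is integrable on `Fˣ`: its norm is
`√(|t|ᴺ) |Ψ(t x)| ≤ C · 1_{𝔭^n}(t) |t|^{N/2}` (`Ψ` bounded, supported in a box), and `∫_{𝔭^n} |t|^{N/2} d^×t < ∞`.
[cite: Tate1950, §2.4; MoeglinVignerasWaldspurger1987, Chap. 3 III.7 a)] -/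
theorem integrable_orbital_of_unitary [μ'.IsMulLeftInvariant] [IsFiniteMeasureOnCompacts μ'] (hN : 1 ≤ N)
    (hνo : IsOpen (ν.ker : Set Fˣ)) (hνu : ∀ t, ‖((ν t : ℂˣ) : ℂ)‖ = 1) (hχo : IsOpen (χ.ker : Set Fˣ))
    (hχu : ∀ t, ‖((χ t : ℂˣ) : ℂ)‖ = 1) (Ψ : SchwartzBruhat (Fin N → F)) {x : Fin N → F} (hx : x ≠ 0) :
    Integrable (fun t : Fˣ => (((χ t)⁻¹ : ℂˣ) : ℂ) *
      (π (Units.map (Matrix.scalar (Fin N)).toMonoidHom t) Ψ : (Fin N → F) → ℂ) x) μ' := by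
  haveI : BorelSpace Fˣ := Units.borelSpace
  obtain ⟨M, hM⟩ := exists_eq_zero_of_notMem_piPrimePowBall Ψ.2
  obtain ⟨j₀, hj₀⟩ := exists_mem_piPrimePowBall_iff_le hx
  obtain ⟨C, hC⟩ := (Ψ.2.1.continuous).bounded_above_of_compact_support Ψ.2.2
  simp_rw [orbitalIntegrand_eq π ν χ hπ]
  have hna : Continuous fun t : Fˣ => ((normAbs F (t : F) : ℝ≥0) : ℝ) :=
    NNReal.continuous_coe.comp (LocalFieldHaar.continuous_normAbs.comp Units.continuous_val)
  have hcont : Continuous fun t : Fˣ => ((χ t⁻¹ : ℂˣ) : ℂ) * (((ν t : ℂˣ) : ℂ) ^ N *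
      ((Real.sqrt ((normAbs F (t : F) : ℝ) ^ N) : ℂ) * (Ψ : (Fin N → F) → ℂ) ((t : F) • x))) :=
    ((continuous_coe_of_isOpen_ker χ hχo).comp continuous_inv).mul
      (((continuous_coe_of_isOpen_ker ν hνo).pow N).mul
        ((Complex.continuous_ofReal.comp (Real.continuous_sqrt.comp (hna.pow N))).mul
          (Ψ.2.1.continuous.comp (Units.continuous_val.smul continuous_const))))
  refine integrable_units_of_norm_le μ' hcont.aestronglyMeasurable (M - j₀) (t := (N : ℝ) / 2) (by positivity) C
    fun t => ?_
  rw [norm_mul, norm_mul, norm_mul, hχu, one_mul, norm_pow, hνu, one_pow, one_mul, Complex.norm_real,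
    Real.norm_of_nonneg (Real.sqrt_nonneg _), Real.sqrt_eq_rpow, ← Real.rpow_natCast,
    ← Real.rpow_mul (NNReal.coe_nonneg _), mul_one_div]
  by_cases ht : (t : F) ∈ primePowBall F (M - j₀)
  · rw [Set.indicator_of_mem (show t ∈ {t : Fˣ | (t : F) ∈ primePowBall F (M - j₀)} from ht), mul_comm C]
    exact mul_le_mul_of_nonneg_left (hC _) (Real.rpow_nonneg (NNReal.coe_nonneg _) _)
  · have hzero : (Ψ : (Fin N → F) → ℂ) ((t : F) • x) = 0 := by
      apply hM
      obtain ⟨k, hk⟩ := exists_normAbs_eq_inv_zpow (Units.ne_zero t)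
      rw [smul_mem_piPrimePowBall_iff hk, hj₀]
      intro hle
      apply ht
      rw [mem_primePowBall_iff, hk]
      exact zpow_le_zpow_right_of_le_one₀ inv_residueFieldCard_pos inv_residueFieldCard_lt_one.le (by omega)
    rw [hzero, norm_zero, mul_zero,
      Set.indicator_of_notMem (show t ∉ {t : Fˣ | (t : F) ∈ primePowBall F (M - j₀)} from ht), mul_zero]

end Convergence

/-! ## §4 The central character and the `Q_{N-1,1}`-covariance of the line functional -/

section Covariance

variable {F : Type} [Field F] [ValuativeRel F] [TopologicalSpace F] [IsNonarchimedeanLocalField F]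
  [MeasurableSpace F] [BorelSpace F] {N : ℕ}
  (π : Representation ℂ (GL (Fin N) F) (SchwartzBruhat (Fin N → F))) (ν χ : Fˣ →* ℂˣ)
  (hπ : ∀ (a : GL (Fin N) F) (Ψ : SchwartzBruhat (Fin N → F)),
    π a Ψ = ((ν (Matrix.GeneralLinearGroup.det a) : ℂˣ) : ℂ) • leviOpPi (glEquiv (GLn.contragredient a)) Ψ)
  (μ' : Measure Fˣ)

/-- **the centre acts on the line functional through `χ`**: `λ(π(t₀·1)Ψ) = χ(t₀) λ(Ψ)` (Haar invariance;
`SchwartzPiHomothetyCoinvariants.integral_apply_rel` for `π ∘ (t ↦ t·1)`). [cite: MoeglinVignerasWaldspurger1987, Chap. 3 §III.3] -/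
theorem integral_scalar_apply [μ'.IsMulLeftInvariant] (t₀ : Fˣ) (Ψ : SchwartzBruhat (Fin N → F)) (x : Fin N → F) :
    ∫ t, (((χ t)⁻¹ : ℂˣ) : ℂ) * (π (Units.map (Matrix.scalar (Fin N)).toMonoidHom t)
      (π (Units.map (Matrix.scalar (Fin N)).toMonoidHom t₀) Ψ) : (Fin N → F) → ℂ) x ∂μ' =
      ((χ t₀ : ℂˣ) : ℂ) * ∫ t, (((χ t)⁻¹ : ℂˣ) : ℂ) *
        (π (Units.map (Matrix.scalar (Fin N)).toMonoidHom t) Ψ : (Fin N → F) → ℂ) x ∂μ' :=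
  integral_apply_rel (π.comp (Units.map (Matrix.scalar (Fin N)).toMonoidHom)) χ μ' t₀ Ψ x

omit [ValuativeRel F] [TopologicalSpace F] [IsNonarchimedeanLocalField F] [MeasurableSpace F] [BorelSpace F] in
/-- the `GL_1`-block of `q ∈ Q_{N-1,1}` has determinant the corner entry `q_{N-1,N-1}`. [cite: Zelevinsky1980, §1.1, p. 170] -/
theorem coe_det_leviProjection_true (hN : 1 ≤ N) (q : standardParabolicGL F (lastBlockLabel N)) :
    ((Matrix.GeneralLinearGroup.det (leviProjection F (lastBlockLabel N) q true) : Fˣ) : F) =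
      ((q : GL (Fin N) F) : Matrix (Fin N) (Fin N) F) ⟨N - 1, by omega⟩ ⟨N - 1, by omega⟩ := by
  haveI : Subsingleton {i : Fin N // lastBlockLabel N i = true} := ⟨fun a b => Subtype.ext (by
    have ha := a.2; have hb := b.2
    rw [Zelevinsky1980.lastBlockLabel_apply, decide_eq_true_eq] at ha hb
    exact Fin.ext (by omega))⟩
  rw [Matrix.GeneralLinearGroup.val_det_apply,
    Matrix.det_eq_elem_of_subsingleton _ (⟨⟨N - 1, by omega⟩, lastBlockLabel_last hN⟩ :
      {i : Fin N // lastBlockLabel N i = true}), leviProjection_apply_coe]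

omit [ValuativeRel F] [TopologicalSpace F] [IsNonarchimedeanLocalField F] [MeasurableSpace F] [BorelSpace F] in
/-- `ᵗ(t·1 · q) e = (t · q_{N-1,N-1}) • e` for `q ∈ Q_{N-1,1}`. [cite: Zelevinsky1980, §1.1, p. 170] -/
theorem transpose_scalar_mul_mulVec_single_last (hN : 1 ≤ N) (t : Fˣ) (q : standardParabolicGL F (lastBlockLabel N)) :
    (((Units.map (Matrix.scalar (Fin N)).toMonoidHom t * (q : GL (Fin N) F) : GL (Fin N) F) :
        Matrix (Fin N) (Fin N) F))ᵀ *ᵥ Pi.single (⟨N - 1, by omega⟩ : Fin N) (1 : F) =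
      (((t * Matrix.GeneralLinearGroup.det (leviProjection F (lastBlockLabel N) q true) : Fˣ) : F)) •
        Pi.single (⟨N - 1, by omega⟩ : Fin N) (1 : F) := by
  rw [Units.val_mul, coe_scalar, Matrix.smul_mul, Matrix.one_mul, Matrix.transpose_smul, Matrix.smul_mulVec,
    transpose_mulVec_single_last hN, smul_smul, Units.val_mul, coe_det_leviProjection_true hN]

include hπ in
/-- **`Q_{N-1,1}`-covariance of the line functional.**  For `q ∈ Q_{N-1,1}` with corner `λ = q_{N-1,N-1}`:
`λ(π(q)Ψ) = ν(det q) ν(λ)^{-N} χ(λ) · (√|det q| / √(|λ|ᴺ)) · λ(Ψ)` — substitute `t ↦ tλ⁻¹` in the orbital integral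
(`ᵗq e = λe`).  With `√|det q| / √(|λ|ᴺ) = |det A|^{1/2} |λ|^{(1-N)/2} = δ_{Q}^{1/2}(q)` this is the inducing character
`(ν∘det ⊠ χν^{1-N}) δ^{1/2}` of [Liu2021, App. D, proof of Lem. D.1]. [cite: MoeglinVignerasWaldspurger1987, Chap. 3 III.7 a)] -/
theorem integral_parabolic_apply [μ'.IsMulLeftInvariant] (hN : 1 ≤ N) (q : standardParabolicGL F (lastBlockLabel N))
    (Ψ : SchwartzBruhat (Fin N → F)) :
    ∫ t, (((χ t)⁻¹ : ℂˣ) : ℂ) * (π (Units.map (Matrix.scalar (Fin N)).toMonoidHom t) (π (q : GL (Fin N) F) Ψ) :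
      (Fin N → F) → ℂ) (Pi.single (⟨N - 1, by omega⟩ : Fin N) (1 : F)) ∂μ' =
      (((ν (Matrix.GeneralLinearGroup.det (q : GL (Fin N) F)) : ℂˣ) : ℂ) *
        (((ν (Matrix.GeneralLinearGroup.det (leviProjection F (lastBlockLabel N) q true)) : ℂˣ) : ℂ) ^ N)⁻¹ *
        ((χ (Matrix.GeneralLinearGroup.det (leviProjection F (lastBlockLabel N) q true)) : ℂˣ) : ℂ) *
        ((Real.sqrt (normAbs F ((Matrix.GeneralLinearGroup.det (q : GL (Fin N) F) : Fˣ) : F)) : ℂ) *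
          ((Real.sqrt ((normAbs F ((Matrix.GeneralLinearGroup.det (leviProjection F (lastBlockLabel N) q true) : Fˣ) :
            F) : ℝ) ^ N) : ℂ))⁻¹)) *
      ∫ t, (((χ t)⁻¹ : ℂˣ) : ℂ) * (π (Units.map (Matrix.scalar (Fin N)).toMonoidHom t) Ψ :
        (Fin N → F) → ℂ) (Pi.single (⟨N - 1, by omega⟩ : Fin N) (1 : F)) ∂μ' := by
  haveI : BorelSpace Fˣ := Units.borelSpace
  set lam : Fˣ := Matrix.GeneralLinearGroup.det (leviProjection F (lastBlockLabel N) q true) with hlam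
  set e : Fin N → F := Pi.single (⟨N - 1, by omega⟩ : Fin N) (1 : F) with he
  -- the integrand of `λ(π(q)Ψ)` versus the orbital integrand at `tλ`
  have hI : ∀ t : Fˣ, (((χ t)⁻¹ : ℂˣ) : ℂ) * (π (Units.map (Matrix.scalar (Fin N)).toMonoidHom t)
      (π (q : GL (Fin N) F) Ψ) : (Fin N → F) → ℂ) e =
      (((ν (Matrix.GeneralLinearGroup.det (q : GL (Fin N) F)) : ℂˣ) : ℂ) * (((ν lam : ℂˣ) : ℂ) ^ N)⁻¹ *
        ((χ lam : ℂˣ) : ℂ) * ((Real.sqrt (normAbs F ((Matrix.GeneralLinearGroup.det (q : GL (Fin N) F) : Fˣ) : F)) : ℂ) *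
          ((Real.sqrt ((normAbs F ((lam : Fˣ) : F) : ℝ) ^ N) : ℂ))⁻¹)) *
        ((((χ (t * lam))⁻¹ : ℂˣ) : ℂ) * (π (Units.map (Matrix.scalar (Fin N)).toMonoidHom (t * lam)) Ψ :
          (Fin N → F) → ℂ) e) := by
    intro t
    have hsqrt_ne : ∀ u : Fˣ, ((Real.sqrt ((normAbs F ((u : Fˣ) : F) : ℝ) ^ N) : ℂ)) ≠ 0 := fun u => by
      rw [Ne, Complex.ofReal_eq_zero, Real.sqrt_eq_zero (pow_nonneg (NNReal.coe_nonneg _) _)]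
      exact pow_ne_zero _ (by exact_mod_cast (normAbs_units_ne_zero u))
    have hsqrt_ne' : ∀ u : Fˣ, ((Real.sqrt (normAbs F ((u : Fˣ) : F)) : ℂ)) ≠ 0 := fun u => by
      rw [Ne, Complex.ofReal_eq_zero, Real.sqrt_eq_zero (NNReal.coe_nonneg _)]
      exact_mod_cast (normAbs_units_ne_zero u)
    rw [← Module.End.mul_apply, ← MonoidHom.map_mul π, apply_apply π ν hπ, apply_apply π ν hπ, he,
      transpose_scalar_mul_mulVec_single_last hN, ← hlam, coe_scalar (t * lam), Matrix.transpose_smul,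
      Matrix.transpose_one, Matrix.smul_mulVec, Matrix.one_mulVec, modSqrt_glEquiv_contragredient,
      modSqrt_glEquiv_contragredient, MonoidHom.map_mul Matrix.GeneralLinearGroup.det, det_scalar, det_scalar]
    -- scalars
    have hsq1 : Real.sqrt (normAbs F (((t ^ N * Matrix.GeneralLinearGroup.det (q : GL (Fin N) F) : Fˣ) : F))) =
        Real.sqrt ((normAbs F (t : F) : ℝ) ^ N) *
          Real.sqrt (normAbs F ((Matrix.GeneralLinearGroup.det (q : GL (Fin N) F) : Fˣ) : F)) := by
      rw [Units.val_mul, Units.val_pow_eq_pow_val, map_mul, map_pow, NNReal.coe_mul, NNReal.coe_pow,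
        Real.sqrt_mul (pow_nonneg (NNReal.coe_nonneg _) _)]
    have hsq2 : Real.sqrt (normAbs F ((((t * lam) ^ N : Fˣ)) : F)) =
        Real.sqrt ((normAbs F (t : F) : ℝ) ^ N) * Real.sqrt ((normAbs F ((lam : Fˣ) : F) : ℝ) ^ N) := by
      rw [Units.val_pow_eq_pow_val, Units.val_mul, map_pow, map_mul, mul_pow, NNReal.coe_mul, NNReal.coe_pow,
        NNReal.coe_pow, Real.sqrt_mul (pow_nonneg (NNReal.coe_nonneg _) _)]
    rw [hsq1, hsq2, map_mul ν, map_pow ν, map_pow ν, map_mul ν, map_mul χ, mul_pow]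
    have hχt : ((χ t : ℂˣ) : ℂ) ≠ 0 := Units.ne_zero _
    have hχl : ((χ lam : ℂˣ) : ℂ) ≠ 0 := Units.ne_zero _
    have hνl : ((ν lam : ℂˣ) : ℂ) ≠ 0 := Units.ne_zero _
    have hνt : ((ν t : ℂˣ) : ℂ) ≠ 0 := Units.ne_zero _
    have h1 := hsqrt_ne t
    have h2 := hsqrt_ne lam
    have h3 := hsqrt_ne' (Matrix.GeneralLinearGroup.det (q : GL (Fin N) F))
    simp only [Units.val_inv_eq_inv_val, Units.val_mul, Units.val_pow_eq_pow_val, mul_inv, Complex.ofReal_mul,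
      Complex.ofReal_inv, inv_inv]
    field_simp
  simp_rw [hI]
  rw [integral_const_mul]
  congr 1
  exact integral_mul_right_eq_self (fun t => (((χ t)⁻¹ : ℂˣ) : ℂ) *
    (π (Units.map (Matrix.scalar (Fin N)).toMonoidHom t) Ψ : (Fin N → F) → ℂ) e) lam

end Covariance

end Literature.NumberTheory.Automorphic.SchwartzPiLine

end
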